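import Literature.NumberTheory.EllipticCurves.ManinConstantFiniteHeightPrimesProofs
import Literature.NumberTheory.EllipticCurves.CuspidalReductionInfiniteHeightProofs
import HarnessLib

/-!
# The Manin constant at a prime with a semistable twist over an extension of `ℤ_p`
# (model-free; every `p`; proofs only)

Topic `NumberTheory/EllipticCurves` (theorems only; no definition, no named fact). In support of
the named fact `Literature.NumberTheory.EllipticCurves.edixhoven_int_of_neronLattice_eq_smul_periodLattice`
(Edixhoven 1991, Prop. 2: `c_f ∈ ℤ`). After `ManinConstantFiniteHeightPrimesProofs` (every prime
that is not additive) and `ManinConstantAdditivePrimesProofs` (additive `p ≥ 5`, through the short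
model and `ℚ_p(p^{1/12})`), the fact is open only at an ADDITIVE prime `p ∈ {2, 3}`. This file
proves the local-to-global step there in MODEL-FREE form and for an ARBITRARY finite extension:

* `padicNorm_le_one_of_neronLattice_eq_smul_periodLattice_of_semistableTwist` — **for the data of
  the fact, a prime `p`, a Honda witness `Σ aₙ(W')Xⁿ/n = log_{W'}(ψ)`, `ψ ∈ Xℤ_p⟦X⟧` (free at an
  additive prime: `CuspidalReductionInfiniteHeightProofs`), a finite extension `K/ℚ_p` with ring of
  integers `O = 𝒪_K`, an element `π ∈ K` with `‖π‖ᵉ = p⁻¹`, an exponent `k < e`, and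
  `r, s, t ∈ O` such that the twist `(πᵏ, r, s, t) • (W' ⊗ K)` is an `O`-curve `V''` whose formal
  group has FINITE HEIGHT (some coefficient of `[p]_{V''}` in positive degree is a unit), one has
  `‖q‖_p ≤ 1`.**

  Proof: by the `x,y`-dictionary (`ModularParamFormalDictionaryProofs`) the parameter
  `t' = θ_C(z)` of `W'` along the modular parametrisation and its `w`-coordinate `w_{W'}(t')` lie in
  `Frac ℤ⟦q⟧` (`exists_int_frac_formalW_smul_subst`), `log_{W'}(t') = u·Σ aₙqⁿ/n`, `[X¹]t' = u`,
  `‖u‖_p = ‖q‖_p`; the isomorphism `θ'' : Ŵ' ⥲ V̂''` of the twist is an `O`-series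
  (`exists_map_eq_formalVariableChange`), so `t'' = θ''(t')` lies in `Frac O⟦q⟧`, has
  `log_{V''}(t'') = πᵏu·Σ aₙqⁿ/n` and `[X¹]t'' = πᵏu`; with `u = n₁/d` in lowest terms
  `[d]_{V''}(t'') = [n₁]_{V''}(θ''(ψ)) ∈ O⟦q⟧`; the Weierstrass-preparation lemma over the complete
  discrete valuation ring `O` (`Literature.RingTheory.PowerSeries.exists_map_eq_of_subst_eq_map`)
  gives `t'' ∈ O⟦q⟧`, so `πᵏ u ∈ O`, and `k < e` forces `‖u‖_p ≤ 1`
  (`Padic.norm_le_one_of_pow_mul_norm_le_one`).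
* `padicNorm_le_one_of_formalLog_subst_eq_of_semistableTwist` — the LOCAL half of that proof
  in isolation (no modular form): a series `t₀ ∈ Xℚ⟦X⟧ ∩ Frac ℤ⟦X⟧` with `w_{W'}(t₀) ∈ Frac ℤ⟦X⟧`,
  `log_{W'}(t₀) = u·Σ aₙ(W')Xⁿ/n`, `[X¹]t₀ = u > 0`, a Honda witness, and a finite-height twist
  over `𝒪_K` with `k < e` force `‖u‖_p ≤ 1`.
* `…_of_semistableTwist_of_dvd_of_dvd` — the same at an additive prime, with the Honda witness
  supplied by `exists_padicInt_formalLog_subst_eq_lSeriesLog_of_dvd_of_dvd`.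

This reduces the two remaining primes of the fact to LOCAL ALGEBRA: exhibiting, for each additive
reduction type at `p = 2, 3`, a semistable twist over some `𝒪_K` with `k < e` (the tame types; for
the wild types with `k ≥ e` the Newton polygon of `[p]_{V''}` on `O⟦q⟧` is needed in addition —
see `NeronIsogenyScaling.lean`, "A finite-height refinement").

## References

* B. Edixhoven, *On the Manin constants of modular elliptic curves*, in: Arithmetic Algebraic
  Geometry (Texel, 1989), Progr. Math. 89 (1991), 25–39, Prop. 2. [EdixhovenManin1991]
* H. Pasten, *Shimura curves and the abc conjecture*, J. Number Theory (2024), §10.1 (p. 33).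
  [PastenShimura2024]
* T. Honda, *On the theory of commutative formal groups*, J. Math. Soc. Japan 22 (1970), 213–246,
  Thm. 2 (p. 223), §6.2 Thm. 9 (pp. 240–241). [Honda1970]
* A. Kraus, *Sur le défaut de semi-stabilité des courbes elliptiques à réduction additive*,
  Manuscripta Math. 69 (1990), 353–385 (semistable models at `p = 2, 3`).
* J. H. Silverman, *The Arithmetic of Elliptic Curves*, 2nd ed. (2009), III.1, IV.1, VII.5.
  [SilvermanAEC2009]
-/

noncomputable section

open scoped Classical IntermediateField

/-! ### Preliminaries: the `w`-coordinate and the twist isomorphism -/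

namespace WeierstrassCurve

open PowerSeries Literature.NumberTheory.EllipticCurves Literature.RingTheory.FormalGroups

section General

variable {R : Type*} [CommRing R] (W : WeierstrassCurve R) (vc : VariableChange R)

/-- `θ(z)·den(z) = u·(z − r·w(z))` read through any `z ∈ XR⟦X⟧` (the version of
`formalVariableChange_subst_mul_denom` over an arbitrary ring). [folklore] -/
theorem subst_formalVariableChange_mul_denom {z : R⟦X⟧} (hz : constantCoeff z = 0) :
    (W.formalVariableChange vc).subst z *
        (1 + C vc.s * z + C (vc.t - vc.s * vc.r) * W.formalW.subst z) =
      C (vc.u : R) * (z - C vc.r * W.formalW.subst z) := by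
  have hzs : HasSubst z := HasSubst.of_constantCoeff_zero' hz
  have h := congrArg (substAlgHom hzs) (W.formalVariableChange_mul_denom vc)
  simp only [formalVariableChangeDenom, map_mul, map_add, map_sub, map_one] at h
  simp only [coe_substAlgHom, subst_X hzs, C_subst] at h
  simpa only [map_sub, map_mul] using h

/-- **`w'(θ(z))·den(z) = u³·w(z)`** read through any `z ∈ XR⟦X⟧`: the `w`-coordinate of the image
point (`formalW_variableChange_subst`). [cite: SilvermanAEC2009, IV.1.1 and III.1] -/
theorem formalW_smul_subst_mul_denom {z : R⟦X⟧} (hz : constantCoeff z = 0) :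
    (vc • W).formalW.subst ((W.formalVariableChange vc).subst z) *
        (1 + C vc.s * z + C (vc.t - vc.s * vc.r) * W.formalW.subst z) =
      C (vc.u : R) ^ 3 * W.formalW.subst z := by
  have hzs : HasSubst z := HasSubst.of_constantCoeff_zero' hz
  have hθs := W.hasSubst_formalVariableChange vc
  have h0 : (vc • W).formalW.subst (W.formalVariableChange vc) * W.formalVariableChangeDenom vc =
      C (vc.u : R) ^ 3 * W.formalW := by
    rw [formalW_variableChange_subst, mul_assoc, mul_comm (invOfUnit _ _),
      formalVariableChangeDenom_mul_invOfUnit, mul_one]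
  have h := congrArg (substAlgHom hzs) h0
  simp only [formalVariableChangeDenom, map_mul, map_add, map_sub, map_one, map_pow] at h
  simp only [coe_substAlgHom, subst_X hzs, C_subst] at h
  rw [subst_comp_subst_apply hθs hzs] at h
  simpa only [map_sub, map_mul] using h

end General

section RatFrac

variable (E : WeierstrassCurve ℚ) (vc : VariableChange ℚ)

/-- **Transport of bounded denominators, `w`-coordinate.** In the setting of
`exists_int_frac_formalVariableChange_subst` (`z, w_E(z) ∈ Frac ℤ⟦X⟧`), the `w`-coordinate
`w'(θ_vc(z)) = u³ w(z)/(1 + sz + (t − sr)w(z))` of the transformed point lies in `Frac ℤ⟦X⟧` as well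
(it is `−1/Y'`). [cite: SilvermanAEC2009, III.1 and IV.1] -/
theorem exists_int_frac_formalW_smul_subst {z : ℚ⟦X⟧} (hz : constantCoeff z = 0)
    {P Q P₂ Q₂ : ℤ⟦X⟧} (hQ : Q ≠ 0) (hPQ : z * Q.map (Int.castRingHom ℚ) = P.map (Int.castRingHom ℚ))
    (hQ₂ : Q₂ ≠ 0)
    (hPQ₂ : E.formalW.subst z * Q₂.map (Int.castRingHom ℚ) = P₂.map (Int.castRingHom ℚ)) :
    ∃ P' Q' : ℤ⟦X⟧, Q' ≠ 0 ∧
      (vc • E).formalW.subst ((E.formalVariableChange vc).subst z) * Q'.map (Int.castRingHom ℚ) =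
        P'.map (Int.castRingHom ℚ) := by
  have key := E.formalW_smul_subst_mul_denom vc hz
  have hw0 : constantCoeff (E.formalW.subst z) = 0 := by
    rw [constantCoeff_subst_eq_constantCoeff hz, E.constantCoeff_formalW]
  set u : ℚ := (vc.u : ℚ) with hu
  set r : ℚ := vc.r with hr
  set s : ℚ := vc.s with hs
  set t : ℚ := vc.t with ht
  set w := E.formalW.subst z with hw
  set w' := (vc • E).formalW.subst ((E.formalVariableChange vc).subst z) with hw'
  set Qq := Q.map (Int.castRingHom ℚ) with hQq
  set Pq := P.map (Int.castRingHom ℚ) with hPq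
  set Q₂q := Q₂.map (Int.castRingHom ℚ) with hQ₂q
  set P₂q := P₂.map (Int.castRingHom ℚ) with hP₂q
  -- a common denominator `M = dᵤ³ d_r d_s d_t` and the integers `M s`, `M t`, `M s r`, `M u³`
  set M : ℤ := u.den ^ 3 * r.den * s.den * t.den with hM
  set ns : ℤ := s.num * u.den ^ 3 * r.den * t.den with hns
  set nt : ℤ := t.num * u.den ^ 3 * r.den * s.den with hnt
  set nsr : ℤ := s.num * r.num * u.den ^ 3 * t.den with hnsr
  set nu3 : ℤ := u.num ^ 3 * r.den * s.den * t.den with hnu3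
  have hdu : (u.den : ℚ) * u = u.num := by rw [mul_comm]; exact Rat.mul_den_eq_num u
  have hdr : (r.den : ℚ) * r = r.num := by rw [mul_comm]; exact Rat.mul_den_eq_num r
  have hds : (s.den : ℚ) * s = s.num := by rw [mul_comm]; exact Rat.mul_den_eq_num s
  have hdt : (t.den : ℚ) * t = t.num := by rw [mul_comm]; exact Rat.mul_den_eq_num t
  have eM : ((M : ℤ) : ℚ) = (u.den : ℚ) ^ 3 * r.den * s.den * t.den := by rw [hM]; push_cast; ring
  have ens : ((ns : ℤ) : ℚ) = (M : ℚ) * s := by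
    rw [hns, eM]; push_cast; linear_combination -((u.den : ℚ) ^ 3 * r.den * t.den) * hds
  have ent : ((nt : ℤ) : ℚ) = (M : ℚ) * t := by
    rw [hnt, eM]; push_cast; linear_combination -((u.den : ℚ) ^ 3 * r.den * s.den) * hdt
  have ensr : ((nsr : ℤ) : ℚ) = (M : ℚ) * s * r := by
    rw [hnsr, eM]; push_cast
    linear_combination -((u.den : ℚ) ^ 3 * t.den * r.num) * hds - ((u.den : ℚ) ^ 3 * t.den * s.den * s) * hdr
  have enu3 : ((nu3 : ℤ) : ℚ) = (M : ℚ) * u ^ 3 := by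
    rw [hnu3, eM]; push_cast
    linear_combination -((r.den : ℚ) * s.den * t.den * (u.num ^ 2 + u.num * (u.den * u) + (u.den * u) ^ 2)) * hdu
  refine ⟨C nu3 * Q * P₂, C M * Q * Q₂ + C ns * P * Q₂ + C (nt - nsr) * Q * P₂, ?_, ?_⟩
  · -- `Q' ≠ 0`: its image in `ℚ⟦X⟧` is `M · Q · Q₂ · den(z)` with `den(z)(0) = 1`
    intro h0
    have h0' := congrArg (PowerSeries.map (Int.castRingHom ℚ)) h0
    rw [map_zero] at h0'
    have hden : (PowerSeries.map (Int.castRingHom ℚ))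
        (C M * Q * Q₂ + C ns * P * Q₂ + C (nt - nsr) * Q * P₂) =
        C (M : ℚ) * Qq * Q₂q * (1 + C s * z + C (t - s * r) * w) := by
      simp only [map_add, map_mul, map_sub, map_C, ← hQq, ← hPq, ← hQ₂q, ← hP₂q]
      simp only [eq_intCast]
      rw [ens, ent, ensr]
      simp only [map_mul]
      linear_combination (C (M : ℚ) * C s * Q₂q) * hPQ.symm +
        (C (M : ℚ) * (C t - C s * C r) * Qq) * hPQ₂.symm
    rw [hden] at h0'
    have hM0 : (M : ℚ) ≠ 0 := by
      rw [eM]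
      exact_mod_cast mul_ne_zero (mul_ne_zero (mul_ne_zero (pow_ne_zero 3 u.den_nz) r.den_nz) s.den_nz)
        t.den_nz
    have hQq0 : Qq ≠ 0 := fun h ↦ hQ (PowerSeries.map_injective (Int.castRingHom ℚ) Int.cast_injective
      (by rw [← hQq, h, map_zero]))
    have hQ₂q0 : Q₂q ≠ 0 := fun h ↦ hQ₂ (PowerSeries.map_injective (Int.castRingHom ℚ) Int.cast_injective
      (by rw [← hQ₂q, h, map_zero]))
    have hden0 : (1 + C s * z + C (t - s * r) * w : ℚ⟦X⟧) ≠ 0 := by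
      intro h
      have h1 := congrArg constantCoeff h
      rw [map_add, map_add, map_mul, map_mul, hz, hw0] at h1
      simp at h1
    have hCM : (C (M : ℚ) : ℚ⟦X⟧) ≠ 0 := by
      intro h; apply hM0; simpa using congrArg constantCoeff h
    exact (mul_ne_zero (mul_ne_zero (mul_ne_zero hCM hQq0) hQ₂q0) hden0) h0'
  · -- the identity `w'·Q' = P'`
    simp only [map_add, map_mul, map_sub, map_C, ← hQq, ← hPq, ← hQ₂q, ← hP₂q]
    simp only [eq_intCast]
    rw [ens, ent, ensr, enu3]
    simp only [map_mul, map_sub, map_pow] at key ⊢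
    linear_combination (C (M : ℚ) * Qq * Q₂q) * key +
      (w' * C (M : ℚ) * C s * Q₂q) * hPQ.symm +
      (w' * C (M : ℚ) * (C t - C s * C r) * Qq - C (M : ℚ) * C u ^ 3 * Qq) * hPQ₂.symm

end RatFrac

section IntegralTheta

variable {O K : Type*} [CommRing O] [CommRing K] [Algebra O K]

/-- **The twist isomorphism is integral.** For an `O`-curve `V`, a change of variables `C` over an
`O`-algebra `K` whose entries `u, r, s, t` all come from `O` (`u` need not be a unit of `O`:
`u = πᵏ`), the isomorphism `θ_C = u(X − r w)/(1 + sX + (t − sr)w)` of formal groups is the image of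
a series `θ₀ ∈ XO⟦X⟧` with `[X¹]θ₀ = u`. [cite: SilvermanAEC2009, III.1 and IV.1] -/
theorem exists_map_eq_formalVariableChange (V : WeierstrassCurve O) (C' : VariableChange K)
    (u r s t : O) (hu : (C'.u : K) = algebraMap O K u) (hr : C'.r = algebraMap O K r)
    (hs : C'.s = algebraMap O K s) (ht : C'.t = algebraMap O K t) :
    ∃ θ₀ : O⟦X⟧, θ₀.map (algebraMap O K) = (V.map (algebraMap O K)).formalVariableChange C' ∧
      constantCoeff θ₀ = 0 ∧ coeff 1 θ₀ = u := by
  set W := V.map (algebraMap O K) with hW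
  set den₀ : O⟦X⟧ := 1 + C s * X + C (t - s * r) * V.formalW with hden₀
  set θ₀ : O⟦X⟧ := C u * (X - C r * V.formalW) * invOfUnit den₀ 1 with hθ₀
  have hden₀c : constantCoeff den₀ = 1 := by simp [hden₀, V.constantCoeff_formalW]
  have hden₀inv : den₀ * invOfUnit den₀ 1 = 1 := mul_invOfUnit den₀ 1 (by rw [hden₀c, Units.val_one])
  have hmapden : den₀.map (algebraMap O K) = W.formalVariableChangeDenom C' := by
    rw [hden₀, formalVariableChangeDenom, hW, ← map_formalW]
    simp only [map_add, map_mul, map_one, map_C, map_X, map_sub, hs, ht, hr]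
  refine ⟨θ₀, ?_, ?_, ?_⟩
  · -- both are `u(X − r w)/den`
    apply (W.isUnit_formalVariableChangeDenom C').mul_left_injective
    change θ₀.map (algebraMap O K) * W.formalVariableChangeDenom C' =
      W.formalVariableChange C' * W.formalVariableChangeDenom C'
    rw [formalVariableChange_mul_denom, ← hmapden, ← map_mul, hθ₀, mul_assoc,
      mul_comm (invOfUnit _ _), hden₀inv, mul_one, hW, ← map_formalW]
    simp only [map_mul, map_sub, map_C, map_X, hu, hr]
  · simp [hθ₀, V.constantCoeff_formalW]
  · have hw1 : coeff 1 V.formalW = 0 := V.coeff_formalW_of_lt_three (by norm_num)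
    have hw0 : constantCoeff V.formalW = 0 := V.constantCoeff_formalW
    rw [hθ₀, PowerSeries.coeff_one_mul, PowerSeries.coeff_one_mul]
    simp [hw0, hw1, coeff_one_X, constantCoeff_invOfUnit]

end IntegralTheta

end WeierstrassCurve

/-! ### The theorem -/

namespace Literature.NumberTheory.EllipticCurves

open PowerSeries Literature.RingTheory.FormalGroups Literature.NumberTheory.EllipticCurves.ModularForms
open Literature.NumberTheory.EllipticCurves.HondaCongruence Literature.NumberTheory.Automorphic
open Literature.NumberTheory.GaloisRepresentations
open _root_.WeierstrassCurve
open scoped MatrixGroups ModularForm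
open CongruenceSubgroup IsLocalRing

set_option maxHeartbeats 4000000 in
/-- **The local step, model-free, over a finite extension.** Let `W'/ℚ` be globally minimal, `p` a
prime, `t₀ ∈ Xℚ⟦X⟧` a series with `log_{W'}(t₀) = u · Σ aₙ(W')Xⁿ/n` for a rational `u > 0`,
`[X¹]t₀ = u`, such that `t₀` and `w_{W'}(t₀)` lie in `Frac ℤ⟦X⟧`; let `ψ ∈ Xℤ_p⟦X⟧` be a Honda
witness (`log_{W' ⊗ ℚ_p}(ψ) = Σ aₙXⁿ/n`); and let `K/ℚ_p` be finite with `O = 𝒪_K`, `π ∈ Kˣ` with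
`‖π‖ᵉ = p⁻¹`, `k < e`, `r, s, t ∈ O`, `V''/O` with `V'' ⊗ K = (πᵏ, r, s, t) • (W' ⊗ K)` and a
unit coefficient of `[p]_{V''}` in positive degree. Then `‖u‖_p ≤ 1`. (Steps 5–9 of the module
docstring: `t'' = θ(t₀) ∈ Frac O⟦X⟧`, `[d]_{V''}(t'') = [n₁]_{V''}(θ(ψ)) ∈ O⟦X⟧`, the local lemma
over `O`, `πᵏu ∈ O`.) [cite: Honda1970, Thm. 2 (p. 223)] [cite: EdixhovenManin1991, Prop. 2] -/
theorem padicNorm_le_one_of_formalLog_subst_eq_of_semistableTwist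
    (W' : WeierstrassCurve ℚ) [W'.IsElliptic] [W'.IsGloballyMinimal] {p : ℕ} [Fact p.Prime]
    {u : ℚ} (hCpos : 0 < u) {t₀ : ℚ⟦X⟧} (ht₀0 : constantCoeff t₀ = 0) (ht₀1 : coeff 1 t₀ = u)
    (hlog₀ : W'.formalLog.subst t₀ = C u * PowerSeries.mk fun n ↦ ((W'.LFunction n : ℤ) : ℚ) / n)
    {P' Q' P₂' Q₂' : ℤ⟦X⟧} (hQ' : Q' ≠ 0)
    (hPQ' : t₀ * Q'.map (Int.castRingHom ℚ) = P'.map (Int.castRingHom ℚ)) (hQ₂' : Q₂' ≠ 0)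
    (hPQ₂' : W'.formalW.subst t₀ * Q₂'.map (Int.castRingHom ℚ) = P₂'.map (Int.castRingHom ℚ))
    (hψex : ∃ ψ : ℚ_[p]⟦X⟧, constantCoeff ψ = 0 ∧ (∀ n, ‖coeff n ψ‖ ≤ 1) ∧
      (W'.map (algebraMap ℚ ℚ_[p])).formalLog.subst ψ =
        PowerSeries.mk fun k ↦ ((W'.LFunction k : ℤ) : ℚ_[p]) / k)
    (K : IntermediateField ℚ_[p] (PadicAlgCl p)) [FiniteDimensional ℚ_[p] K]
    (πu : Kˣ) {e k : ℕ} (hπe : ‖((πu : K) : PadicAlgCl p)‖ ^ e = (p : ℝ)⁻¹) (hke : k < e)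
    (r s t : padicCoeffRing K) (V'' : WeierstrassCurve (padicCoeffRing K))
    (hV'' : V''.map (algebraMap (padicCoeffRing K) K) =
      (⟨πu ^ k, (r : K), (s : K), (t : K)⟩ : VariableChange K) • W'.map (algebraMap ℚ K))
    (hfin : ∃ J : ℕ, 0 < J ∧ IsUnit (coeff J (V''.formalMul p))) :
    ‖((u : ℚ) : ℚ_[p])‖ ≤ 1 := by
  have ht₀s : HasSubst t₀ := HasSubst.of_constantCoeff_zero' ht₀0
  /- Step 5: the ring `(padicCoeffRing K) = 𝒪_K` (a complete DVR), `π`, and the maps. -/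
  letI hOloc : IsLocalRing (padicCoeffRing K) := isLocalRing_padicCoeffRing K
  haveI hOpid : IsPrincipalIdealRing (padicCoeffRing K) := isPrincipalIdealRing_padicCoeffRing K
  haveI hOcpl : IsAdicComplete (maximalIdeal (padicCoeffRing K)) (padicCoeffRing K) := isAdicComplete_padicCoeffRing K
  letI hOch : CharP (ResidueField (padicCoeffRing K)) p := charP_residueField_padicCoeffRing K
  have hp1R : (1 : ℝ) < p := by exact_mod_cast (Fact.out : p.Prime).one_lt
  set π : PadicAlgCl p := ((πu : K) : PadicAlgCl p) with hπdef
  have he0 : e ≠ 0 := by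
    rintro rfl
    rw [pow_zero] at hπe
    exact absurd hπe.symm (ne_of_lt (inv_lt_one_of_one_lt₀ hp1R))
  have hπle : ‖π‖ ≤ 1 := by
    by_contra hcon
    rw [not_le] at hcon
    have h1 : (1 : ℝ) < ‖π‖ ^ e := one_lt_pow₀ hcon he0
    rw [hπe] at h1
    exact absurd h1 (not_lt.mpr (inv_le_one_of_one_le₀ hp1R.le))
  have hπlt : ‖π‖ < 1 := by
    by_contra hcon
    rw [not_lt] at hcon
    have h1 : (1 : ℝ) ≤ ‖π‖ ^ e := one_le_pow₀ hcon
    rw [hπe] at h1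
    exact absurd h1 (not_le.mpr (inv_lt_one_of_one_lt₀ hp1R))
  set πO : (padicCoeffRing K) := ⟨(πu : K), (mem_padicCoeffRing_iff K _).mpr hπle⟩ with hπOdef
  have hπOc : ((πO : (padicCoeffRing K)) : K) = (πu : K) := rfl
  have hπOmax : πO ∈ maximalIdeal (padicCoeffRing K) := by
    rw [mem_maximalIdeal_padicCoeffRing_iff, hπOc]; exact hπlt
  set ι : ℤ_[p] →+* (padicCoeffRing K) := padicIntToCoeffRing K with hιdef
  set φK : ℚ_[p] →+* K := algebraMap ℚ_[p] K with hφK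
  set φ : ℚ →+* ℚ_[p] := algebraMap ℚ ℚ_[p] with hφ
  set φQ : ℚ →+* K := algebraMap ℚ K with hφQ
  have halgO : ∀ y : (padicCoeffRing K), algebraMap (padicCoeffRing K) K y = (y : K) := fun y ↦ rfl
  have hinjO : Function.Injective (algebraMap (padicCoeffRing K) K) := fun x y h ↦ Subtype.ext h
  have hιφ : ∀ x : ℤ_[p], algebraMap (padicCoeffRing K) K (ι x) = φK (x : ℚ_[p]) := fun x ↦ rfl
  have hcomp : φK.comp φ = φQ := RingHom.ext fun x ↦ by
    rw [eq_ratCast (φK.comp φ) x, eq_ratCast φQ x]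
  have hmm : ∀ R : ℤ_[p]⟦X⟧, (R.map ι).map (algebraMap (padicCoeffRing K) K) =
      (R.map (algebraMap ℤ_[p] ℚ_[p])).map φK := fun R ↦ by
    ext n
    simp only [coeff_map, hιφ]
    rfl
  have hintQ : ∀ R : ℤ⟦X⟧, ((R.map (Int.castRingHom ℤ_[p])).map ι).map (algebraMap (padicCoeffRing K) K) =
      (R.map (Int.castRingHom ℚ)).map φQ := fun R ↦ by
    ext n
    simp [coeff_map]
  /- Step 6: the curves over `K`: `WK = W' ⊗ K = VO ⊗ K`, the twist `W'' = C'' • WK = V'' ⊗ K`,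
  the integral isomorphism `θ`, and the series `t''`, its logarithm, its `Frac (padicCoeffRing K)⟦X⟧`-witness. -/
  set WK : WeierstrassCurve K := W'.map φQ with hWK
  set VO : WeierstrassCurve (padicCoeffRing K) := (integralModelInt W').map (Int.castRingHom (padicCoeffRing K)) with hVO
  have hVOK : VO.map (algebraMap (padicCoeffRing K) K) = WK := by
    have h1 : ((integralModelInt W').map (Int.castRingHom ℚ)).map φQ = W'.map φQ := by
      rw [map_integralModelInt]
    rw [map_map] at h1
    rw [hVO, map_map, hWK]
    exact (congrArg (integralModelInt W').map (RingHom.ext_int _ _)).trans h1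
  set C'' : VariableChange K := ⟨πu ^ k, (r : K), (s : K), (t : K)⟩ with hC''
  set W'' : WeierstrassCurve K := C'' • WK with hW''
  have hV''K : V''.map (algebraMap (padicCoeffRing K) K) = W'' := by rw [hW'', hC'', hWK, hV'']
  obtain ⟨θ₀, hθ₀, hθ₀0, hθ₀1⟩ := VO.exists_map_eq_formalVariableChange C'' (πO ^ k) r s t
    (by rw [hC'', Units.val_pow_eq_pow_val, map_pow, halgO, hπOc]) rfl rfl rfl
  rw [hVOK] at hθ₀
  set θ := WK.formalVariableChange C'' with hθ
  have hθ0 : constantCoeff θ = 0 := WK.constantCoeff_formalVariableChange C''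
  have hθs : HasSubst θ := HasSubst.of_constantCoeff_zero' hθ0
  have hθ₀s : HasSubst θ₀ := HasSubst.of_constantCoeff_zero' hθ₀0
  -- `t₀` over `K` and `t'' = θ(t₀)`
  set t₀K : K⟦X⟧ := t₀.map φQ with ht₀K
  have ht₀K0 : constantCoeff t₀K = 0 := by
    rw [ht₀K, ← coeff_zero_eq_constantCoeff, coeff_map, coeff_zero_eq_constantCoeff, ht₀0, map_zero]
  have ht₀Ks : HasSubst t₀K := HasSubst.of_constantCoeff_zero' ht₀K0
  have ht₀K1 : coeff 1 t₀K = φQ u := by rw [ht₀K, coeff_map, ht₀1]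
  set ℓK : K⟦X⟧ := PowerSeries.mk fun k ↦ ((W'.LFunction k : ℤ) : K) / k with hℓK
  have hℓ' : (PowerSeries.mk fun n ↦ ((W'.LFunction n : ℤ) : ℚ) / n).map φQ = ℓK := by
    ext n; rw [coeff_map, coeff_mk, hℓK, coeff_mk, map_div₀, map_natCast, map_intCast]
  have hlogK : WK.formalLog.subst t₀K = C (φQ u) * ℓK := by
    rw [ht₀K, hWK, ← W'.map_formalLog φQ, ← powerSeries_map_subst ht₀s φQ, hlog₀, map_mul, map_C, hℓ']
  set t'' : K⟦X⟧ := θ.subst t₀K with ht''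
  have ht''0 : constantCoeff t'' = 0 := (constantCoeff_subst_eq_constantCoeff ht₀K0).trans hθ0
  have ht''s : HasSubst t'' := HasSubst.of_constantCoeff_zero' ht''0
  have ht''1 : coeff 1 t'' = (πu : K) ^ k * φQ u := by
    rw [ht'', hθ, WK.coeff_one_formalVariableChange_subst C'' ht₀K0, ht₀K1, hC'', Units.val_pow_eq_pow_val]
  have hlog'' : W''.formalLog.subst t'' = C ((πu : K) ^ k) * (C (φQ u) * ℓK) := by
    rw [ht'', hW'', hθ, WK.formalLog_subst_formalVariableChange_subst C'' ht₀K0, hlogK, hC'',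
      Units.val_pow_eq_pow_val]
  -- the `Frac (padicCoeffRing K)⟦X⟧`-witness for `t''`: `t''·(Q'Q₂' + sP'Q₂' + (t − sr)Q'P₂') = πᵏ(P'Q₂' − rQ'P₂')`
  have hwK : WK.formalW.subst t₀K = PowerSeries.map φQ (W'.formalW.subst t₀) := by
    rw [ht₀K, hWK, ← map_formalW, powerSeries_map_subst ht₀s φQ]
  have keyK := WK.subst_formalVariableChange_mul_denom C'' ht₀K0
  rw [← hθ, ← ht'', hwK] at keyK
  set iO : ℤ⟦X⟧ → (padicCoeffRing K)⟦X⟧ := fun R ↦ (R.map (Int.castRingHom ℤ_[p])).map ι with hiO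
  set Q'' : (padicCoeffRing K)⟦X⟧ := iO Q' * iO Q₂' + C s * iO P' * iO Q₂' + C (t - s * r) * iO Q' * iO P₂' with hQ''
  set P'' : (padicCoeffRing K)⟦X⟧ := C (πO ^ k) * (iO P' * iO Q₂' - C r * iO Q' * iO P₂') with hP''
  have hmapP' : (iO P').map (algebraMap (padicCoeffRing K) K) = (P'.map (Int.castRingHom ℚ)).map φQ := hintQ P'
  have hmapQ' : (iO Q').map (algebraMap (padicCoeffRing K) K) = (Q'.map (Int.castRingHom ℚ)).map φQ := hintQ Q'
  have hmapP₂' : (iO P₂').map (algebraMap (padicCoeffRing K) K) = (P₂'.map (Int.castRingHom ℚ)).map φQ := hintQ P₂'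
  have hmapQ₂' : (iO Q₂').map (algebraMap (padicCoeffRing K) K) = (Q₂'.map (Int.castRingHom ℚ)).map φQ := hintQ Q₂'
  have hPQ'K : t₀K * (Q'.map (Int.castRingHom ℚ)).map φQ = (P'.map (Int.castRingHom ℚ)).map φQ := by
    rw [ht₀K, ← map_mul, hPQ']
  have hPQ₂'K : PowerSeries.map φQ (W'.formalW.subst t₀) * (Q₂'.map (Int.castRingHom ℚ)).map φQ =
      (P₂'.map (Int.castRingHom ℚ)).map φQ := by
    rw [← map_mul, hPQ₂']
  have hCs : (C s : (padicCoeffRing K)⟦X⟧).map (algebraMap (padicCoeffRing K) K) = C C''.s := by rw [map_C, halgO, hC'']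
  have hCr : (C r : (padicCoeffRing K)⟦X⟧).map (algebraMap (padicCoeffRing K) K) = C C''.r := by rw [map_C, halgO, hC'']
  have hCtsr : (C (t - s * r) : (padicCoeffRing K)⟦X⟧).map (algebraMap (padicCoeffRing K) K) = C (C''.t - C''.s * C''.r) := by
    rw [map_C, map_sub, map_mul, halgO, halgO, halgO, hC'']
  have hCπ : (C (πO ^ k) : (padicCoeffRing K)⟦X⟧).map (algebraMap (padicCoeffRing K) K) = C ((C''.u : Kˣ) : K) := by
    rw [map_C, map_pow, halgO, hπOc, hC'', Units.val_pow_eq_pow_val]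
  have hQ''K : Q''.map (algebraMap (padicCoeffRing K) K) =
      (Q'.map (Int.castRingHom ℚ)).map φQ * (Q₂'.map (Int.castRingHom ℚ)).map φQ *
        (1 + C C''.s * t₀K + C (C''.t - C''.s * C''.r) * PowerSeries.map φQ (W'.formalW.subst t₀)) := by
    rw [hQ'']
    simp only [map_add, map_mul, hmapP', hmapQ', hmapP₂', hmapQ₂', hCs, hCtsr]
    linear_combination (C C''.s * (Q₂'.map (Int.castRingHom ℚ)).map φQ) * hPQ'K.symm +
      (C (C''.t - C''.s * C''.r) * (Q'.map (Int.castRingHom ℚ)).map φQ) * hPQ₂'K.symm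
  have hP''K : P''.map (algebraMap (padicCoeffRing K) K) =
      C ((C''.u : Kˣ) : K) * ((P'.map (Int.castRingHom ℚ)).map φQ * (Q₂'.map (Int.castRingHom ℚ)).map φQ -
        C C''.r * (Q'.map (Int.castRingHom ℚ)).map φQ * (P₂'.map (Int.castRingHom ℚ)).map φQ) := by
    rw [hP'']
    simp only [map_mul, map_sub, hmapP', hmapQ', hmapP₂', hmapQ₂', hCr, hCπ]
  have hQ''0 : Q'' ≠ 0 := by
    intro h0
    have h0' := congrArg (PowerSeries.map (algebraMap (padicCoeffRing K) K)) h0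
    rw [map_zero, hQ''K] at h0'
    have hQ'0 : (Q'.map (Int.castRingHom ℚ)).map φQ ≠ 0 := by
      intro h
      apply hQ'
      apply PowerSeries.map_injective (Int.castRingHom ℚ) Int.cast_injective
      apply PowerSeries.map_injective φQ φQ.injective
      rw [h, map_zero, map_zero]
    have hQ₂'0 : (Q₂'.map (Int.castRingHom ℚ)).map φQ ≠ 0 := by
      intro h
      apply hQ₂'
      apply PowerSeries.map_injective (Int.castRingHom ℚ) Int.cast_injective
      apply PowerSeries.map_injective φQ φQ.injective
      rw [h, map_zero, map_zero]
    have hden0 : (1 + C C''.s * t₀K + C (C''.t - C''.s * C''.r) * PowerSeries.map φQ (W'.formalW.subst t₀)) ≠ 0 := by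
      intro h
      have h1 := congrArg constantCoeff h
      have hw0 : constantCoeff (PowerSeries.map φQ (W'.formalW.subst t₀)) = 0 := by
        rw [← coeff_zero_eq_constantCoeff, coeff_map, coeff_zero_eq_constantCoeff,
          constantCoeff_subst_eq_constantCoeff ht₀0, W'.constantCoeff_formalW, map_zero]
      rw [map_add, map_add, map_mul, map_mul, ht₀K0, hw0] at h1
      simp at h1
    exact (mul_ne_zero (mul_ne_zero hQ'0 hQ₂'0) hden0) h0'
  have hPQ'' : t'' * Q''.map (algebraMap (padicCoeffRing K) K) = P''.map (algebraMap (padicCoeffRing K) K) := by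
    rw [hQ''K, hP''K]
    linear_combination ((Q'.map (Int.castRingHom ℚ)).map φQ * (Q₂'.map (Int.castRingHom ℚ)).map φQ) * keyK +
      (C ((C''.u : Kˣ) : K) * (Q₂'.map (Int.castRingHom ℚ)).map φQ) * hPQ'K -
      (C ((C''.u : Kˣ) : K) * C C''.r * (Q'.map (Int.castRingHom ℚ)).map φQ) * hPQ₂'K
  /- Step 7: the Honda witness over `K` and `(padicCoeffRing K)`; `u = n₁ / d`; `[d]_{W''}(t'') = [n₁]_{W''}(x)`,
  `x = θ(ψ)`, an `(padicCoeffRing K)`-integral series. -/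
  obtain ⟨ψ, hψ0, hψi, hψ⟩ := hψex
  have hψs : HasSubst ψ := HasSubst.of_constantCoeff_zero' hψ0
  obtain ⟨ψ₁, hψ₁⟩ := isPadicInt_iff_exists_powerSeries_map.mp (isPadicInt_iff_coeff.mpr hψi)
  set ψK : K⟦X⟧ := ψ.map φK with hψK
  have hψK0 : constantCoeff ψK = 0 := by
    rw [hψK, ← coeff_zero_eq_constantCoeff, coeff_map, coeff_zero_eq_constantCoeff, hψ0, map_zero]
  have hψKs : HasSubst ψK := HasSubst.of_constantCoeff_zero' hψK0
  have hψOK : (ψ₁.map ι).map (algebraMap (padicCoeffRing K) K) = ψK := by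
    rw [hmm]; exact congrArg (PowerSeries.map φK) hψ₁
  have hWKp : (W'.map φ).map φK = WK := by rw [hWK, map_map, hcomp]
  have hℓ'' : (PowerSeries.mk fun n ↦ ((W'.LFunction n : ℤ) : ℚ_[p]) / n).map φK = ℓK := by
    ext n; rw [coeff_map, coeff_mk, hℓK, coeff_mk, map_div₀, map_natCast, map_intCast]
  have hlogψK : WK.formalLog.subst ψK = ℓK := by
    rw [hψK, ← hWKp, ← (W'.map φ).map_formalLog φK, ← powerSeries_map_subst hψs φK, hψ, hℓ'']
  set x : K⟦X⟧ := θ.subst ψK with hx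
  have hx0 : constantCoeff x = 0 := (constantCoeff_subst_eq_constantCoeff hψK0).trans hθ0
  have hxs : HasSubst x := HasSubst.of_constantCoeff_zero' hx0
  have hxO : PowerSeries.map (algebraMap (padicCoeffRing K) K) (θ₀.subst (ψ₁.map ι)) = x := by
    rw [powerSeries_map_subst (HasSubst.of_constantCoeff_zero' (by
      rw [← coeff_zero_eq_constantCoeff, coeff_map, coeff_zero_eq_constantCoeff]
      have h := hψ0
      rw [← hψ₁, ← coeff_zero_eq_constantCoeff, coeff_map, coeff_zero_eq_constantCoeff] at h
      rw [PadicInt.coe_eq_zero.mp h, map_zero])) (algebraMap (padicCoeffRing K) K), hθ₀, hψOK, hx, hθ]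
  have hlogx : W''.formalLog.subst x = C ((πu : K) ^ k) * ℓK := by
    rw [hx, hW'', hθ, WK.formalLog_subst_formalVariableChange_subst C'' hψK0, hlogψK, hC'',
      Units.val_pow_eq_pow_val]
  -- `u = n₁ / d`
  set d : ℕ := u.den with hd
  have hd0 : 0 < d := u.den_pos
  have hnum : 0 < u.num := Rat.num_pos.mpr hCpos
  set n₁ : ℕ := u.num.toNat with hn₁
  have hn₁z : ((n₁ : ℕ) : ℤ) = u.num := Int.toNat_of_nonneg hnum.le
  have hdu : (d : K) * φQ u = (n₁ : K) := by
    have h : (u) * d = (u.num : ℚ) := Rat.mul_den_eq_num _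
    rw [← hn₁z] at h
    have h' := congrArg φQ h
    rw [map_mul, map_natCast, Int.cast_natCast, map_natCast] at h'
    rw [mul_comm]
    exact h'
  set wK : K⟦X⟧ := (W''.formalMul n₁).subst x with hwK'
  have hwK0 : constantCoeff wK = 0 :=
    (constantCoeff_subst_eq_constantCoeff hx0).trans (W''.constantCoeff_formalMul n₁)
  have hlogw : W''.formalLog.subst wK = n₁ • (C ((πu : K) ^ k) * ℓK) := by
    rw [hwK', ← subst_comp_subst_apply (W''.hasSubst_formalMul n₁) hxs, W''.formalLog_subst_formalMul_rat n₁,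
      ← coe_substAlgHom hxs, map_nsmul, coe_substAlgHom, hlogx]
  have hdt''0 : constantCoeff ((W''.formalMul d).subst t'') = 0 :=
    (constantCoeff_subst_eq_constantCoeff ht''0).trans (W''.constantCoeff_formalMul d)
  have hlogd : W''.formalLog.subst ((W''.formalMul d).subst t'') = n₁ • (C ((πu : K) ^ k) * ℓK) := by
    rw [← subst_comp_subst_apply (W''.hasSubst_formalMul d) ht''s, W''.formalLog_subst_formalMul_rat d,
      ← coe_substAlgHom ht''s, map_nsmul, coe_substAlgHom, hlog'', nsmul_eq_mul, nsmul_eq_mul,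
      ← map_natCast (C : K →+* K⟦X⟧) d, ← map_natCast (C : K →+* K⟦X⟧) n₁, ← hdu, map_mul]
    ring
  have hGw : (W''.formalMul d).subst t'' = wK :=
    W''.eq_of_formalLog_subst_eq hdt''0 hwK0 (hlogd.trans hlogw.symm)
  -- `[d]_{V''}(t'') = w''`, `w'' = [n₁]_{V''}(θ₀(ψ)) ∈ (padicCoeffRing K)⟦X⟧`
  set w'' : (padicCoeffRing K)⟦X⟧ := (V''.formalMul n₁).subst (θ₀.subst (ψ₁.map ι)) with hw''
  have hψ₁ιs : HasSubst (θ₀.subst (ψ₁.map ι)) := by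
    refine HasSubst.of_constantCoeff_zero' ((constantCoeff_subst_eq_constantCoeff ?_).trans hθ₀0)
    rw [← coeff_zero_eq_constantCoeff, coeff_map, coeff_zero_eq_constantCoeff]
    have h := hψ0
    rw [← hψ₁, ← coeff_zero_eq_constantCoeff, coeff_map, coeff_zero_eq_constantCoeff] at h
    rw [PadicInt.coe_eq_zero.mp h, map_zero]
  have hGz : (V''.formalMul d).subst t'' = w''.map (algebraMap (padicCoeffRing K) K) := by
    rw [← subst_map_algebraMap (V''.formalMul d) ht''s, map_formalMul, hV''K, hGw, hw'',
      powerSeries_map_subst hψ₁ιs (algebraMap (padicCoeffRing K) K), map_formalMul, hV''K, hxO]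
  /- Step 8: finite height of `V'' ⊗ k_K`: a unit coefficient of `[d]_{V''}` in positive degree. -/
  obtain ⟨nn, hnn, hunit⟩ : ∃ nn : ℕ, 0 < nn ∧ IsUnit (coeff nn (V''.formalMul d)) := by
    obtain ⟨J, hJ, hJu⟩ := hfin
    have hP : (V''.map (residue (padicCoeffRing K))).formalMul p ≠ 0 := by
      rw [← map_formalMul]
      intro h0'
      have h := congrArg (coeff J) h0'
      rw [coeff_map, map_zero] at h
      exact (residue_ne_zero_iff_isUnit _ |>.mpr hJu) h
    have hD : (V''.map (residue (padicCoeffRing K))).formalMul d ≠ 0 :=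
      (V''.map (residue (padicCoeffRing K))).formalMul_ne_zero_of_formalMul_prime_ne_zero hP hd0
    obtain ⟨nn, hnn⟩ := exists_coeff_ne_zero_iff_ne_zero.mpr hD
    rw [← map_formalMul, coeff_map] at hnn
    refine ⟨nn, Nat.pos_of_ne_zero ?_, ?_⟩
    · rintro rfl
      apply hnn
      rw [coeff_zero_eq_constantCoeff_apply, V''.constantCoeff_formalMul d, map_zero]
    · by_contra hu
      apply hnn
      exact (residue_eq_zero_iff _).mpr ((IsLocalRing.mem_maximalIdeal _).mpr hu)
  /- Step 9: the local lemma over `(padicCoeffRing K)`, and `‖u‖ ≤ 1`. -/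
  obtain ⟨t₃, ht₃⟩ := Literature.RingTheory.PowerSeries.exists_map_eq_of_subst_eq_map (O := padicCoeffRing K) (L := K)
    hinjO hnn hunit ht''0 hGz hQ''0 hPQ''
  have h1 : algebraMap (padicCoeffRing K) K (coeff 1 t₃) = (πu : K) ^ k * φQ u := by
    rw [← ht''1, ← ht₃, coeff_map]
  have hφQu : φQ u = φK ((u : ℚ) : ℚ_[p]) := by
    rw [← hcomp, RingHom.comp_apply, hφ, eq_ratCast]
  have hnormle : ‖π‖ ^ k * ‖((u : ℚ) : ℚ_[p])‖ ≤ 1 := by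
    have h2 := norm_coe_padicCoeffRing_le K (coeff 1 t₃)
    rw [← halgO, h1, hφQu] at h2
    push_cast at h2
    rw [norm_mul, norm_pow, IntermediateField.coe_algebraMap_apply] at h2
    change ‖π‖ ^ k * ‖(((u : ℚ) : ℚ_[p]) : PadicAlgCl p)‖ ≤ 1 at h2
    rwa [PadicAlgCl.norm_extends] at h2
  exact Padic.norm_le_one_of_pow_mul_norm_le_one (norm_nonneg π) hπe hke hnormle

set_option maxHeartbeats 400000 in
/-- **The Manin-constant multiplier is a `p`-adic integer at a prime with a Honda witness and a
semistable twist with `k < e` over a finite extension — every `p`, model-free.** Data: those of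
`edixhoven_int_of_neronLattice_eq_smul_periodLattice` (`W'/ℚ` globally minimal, `IsNewformOf W' f`,
`Λ_{L'} = q Λ_f` exactly); a prime `p` with a Honda witness
`Σ aₙ(W')Xⁿ/n = log_{W' ⊗ ℚ_p}(ψ)`, `ψ ∈ Xℤ_p⟦X⟧`; a finite `K/ℚ_p` (inside `ℚ̄_p`) with
`O = 𝒪_K = padicCoeffRing K`, a unit `π` of `K` with `‖π‖ᵉ = p⁻¹`, `k < e`, `r, s, t ∈ O`, and an
`O`-curve `V''` with `V'' ⊗ K = (πᵏ, r, s, t) • (W' ⊗ K)` some coefficient of whose `[p]` in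
positive degree is a unit (finite height of `V'' ⊗ k_K`). Then `‖q‖_p ≤ 1`.
[cite: EdixhovenManin1991, Prop. 2] [cite: Honda1970, Thm. 2 (p. 223) and Thm. 9 (pp. 240–241)]
[cite: PastenShimura2024, §10.1 (p. 33)] -/
theorem padicNorm_le_one_of_neronLattice_eq_smul_periodLattice_of_semistableTwist {N : ℕ} [NeZero N]
    {W' : WeierstrassCurve ℚ} [W'.IsElliptic] [W'.IsGloballyMinimal] {f : CuspForm (Gamma0 N) 2}
    {L' : PeriodPair} (hf : IsNewformOf W' f) (hL' : IsNeronLatticeOf (W'.baseChange ℂ) L')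
    {q : ℚ} (hq : ∀ z ∈ periodLattice f, (q : ℂ) * z ∈ L'.lattice)
    (hq' : ∀ z ∈ L'.lattice, ∃ w ∈ periodLattice f, z = q * w)
    {p : ℕ} [Fact p.Prime]
    (hψex : ∃ ψ : ℚ_[p]⟦X⟧, constantCoeff ψ = 0 ∧ (∀ n, ‖coeff n ψ‖ ≤ 1) ∧
      (W'.map (algebraMap ℚ ℚ_[p])).formalLog.subst ψ =
        PowerSeries.mk fun k ↦ ((W'.LFunction k : ℤ) : ℚ_[p]) / k)
    (K : IntermediateField ℚ_[p] (PadicAlgCl p)) [FiniteDimensional ℚ_[p] K]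
    (πu : Kˣ) {e k : ℕ} (hπe : ‖((πu : K) : PadicAlgCl p)‖ ^ e = (p : ℝ)⁻¹) (hke : k < e)
    (r s t : padicCoeffRing K) (V'' : WeierstrassCurve (padicCoeffRing K))
    (hV'' : V''.map (algebraMap (padicCoeffRing K) K) =
      (⟨πu ^ k, (r : K), (s : K), (t : K)⟩ : VariableChange K) • W'.map (algebraMap ℚ K))
    (hfin : ∃ J : ℕ, 0 < J ∧ IsUnit (coeff J (V''.formalMul p))) :
    ‖(q : ℚ_[p])‖ ≤ 1 := by
  /- Step 1: lattices. `q ≠ 0`, `L := q⁻¹ L'` spans `Λ_f`, the short model `E` of `ℂ/Λ_f`. -/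
  have hq0 : q ≠ 0 := by
    rintro rfl
    obtain ⟨w, -, hw⟩ := hq' L'.ω₁ L'.ω₁_mem_lattice
    rw [Rat.cast_zero, zero_mul] at hw
    exact (LinearIndependent.ne_zero 0 L'.indep) (by simpa using hw)
  have hqC : (q : ℂ) ≠ 0 := by exact_mod_cast hq0
  set L : PeriodPair := L'.mulLeft ((q : ℂ)⁻¹) (inv_ne_zero hqC) with hLdef
  have hL : ∀ x, x ∈ L.lattice ↔ x ∈ periodLattice f := fun x ↦ by
    rw [hLdef, PeriodPair.mem_mulLeft_lattice, inv_inv]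
    constructor
    · intro hx
      obtain ⟨w, hw, hxw⟩ := hq' _ hx
      rwa [mul_left_cancel₀ hqC hxw]
    · exact hq x
  have hΛ : L'.lattice = (L.mulLeft (q : ℂ) hqC).lattice := by
    ext z
    rw [PeriodPair.mem_mulLeft_lattice, hL]
    constructor
    · intro hz
      obtain ⟨w, hw, rfl⟩ := hq' z hz
      rwa [← mul_assoc, inv_mul_cancel₀ hqC, one_mul]
    · intro hz
      have h := hq _ hz
      rwa [← mul_assoc, mul_inv_cancel₀ hqC, one_mul] at h
  have hf0 : f ≠ 0 := hf.1.ne_zero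
  have ha : ∀ n, ((W'.LFunction n : ℤ) : ℂ) = cuspCoeff f n := fun n ↦ (hf.2 n).symm
  have hrat : ∀ n, ∃ r : ℚ, (r : ℂ) = cuspCoeff f n := fun n ↦
    ⟨(W'.LFunction n : ℚ), by rw [← ha n, Rat.cast_intCast]⟩
  obtain ⟨⟨q₂, hq₂⟩, ⟨q₃, hq₃⟩⟩ :=
    PeriodPair.ratCast_g₂_g₃_of_lattice_eq_periodLattice f hf0 hrat L hL
  set a₄ : ℚ := -q₂ / 4 with ha₄
  set a₆ : ℚ := -q₃ / 4 with ha₆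
  have h₂ : L.g₂ = -4 * (a₄ : ℂ) := by rw [← hq₂, ha₄]; push_cast; ring
  have h₃ : L.g₃ = -4 * (a₆ : ℂ) := by rw [← hq₃, ha₆]; push_cast; ring
  set E : WeierstrassCurve ℚ := { a₁ := 0, a₂ := 0, a₃ := 0, a₄ := a₄, a₆ := a₆ } with hE
  haveI hEe : E.IsElliptic := isElliptic_shortModel h₂ h₃
  have hEL : IsNeronLatticeOf (E.baseChange ℂ) L := isNeronLatticeOf_shortModel h₂ h₃
  /- Step 2: the modular parametrisation as a formal series `z ∈ Xℚ⟦X⟧ ∩ Frac ℤ⟦X⟧`, with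
  `w_E(z) ∈ Frac ℤ⟦X⟧` as well (the `x,y`-dictionary). -/
  obtain ⟨z, P, Q, P₂, Q₂, hz0, hQ, hPQ, hQ₂, hPQ₂, hlog⟩ := exists_rat_series_formalLog_subst_eq_formalW f hf0
    (W'.LFunction : ℕ → ℤ) ha L (fun x hx ↦ (hL x).mpr hx) a₄ a₆ h₂ h₃
  /- Step 3: `C • E = W'` over `ℚ` with `0 < u(C)` and `‖u(C)‖_p = ‖q‖_p`. -/
  obtain ⟨e₄, e₆⟩ := hL'.c₄_eq_of_lattice_eq_mulLeft hqC hΛ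
  have hc₄E : (E.baseChange ℂ).c₄ = (E.c₄ : ℂ) := by
    simp [WeierstrassCurve.baseChange, WeierstrassCurve.map_c₄]
  have hc₆E : (E.baseChange ℂ).c₆ = (E.c₆ : ℂ) := by
    simp [WeierstrassCurve.baseChange, WeierstrassCurve.map_c₆]
  have h₄ : W'.c₄ = (q ^ 4)⁻¹ * E.c₄ := by
    have h : ((W'.c₄ : ℚ) : ℂ) = (((q ^ 4)⁻¹ * E.c₄ : ℚ) : ℂ) := by
      rw [e₄, hEL.1, hc₄E]; push_cast; ring
    exact_mod_cast h
  have h₆ : W'.c₆ = (q ^ 6)⁻¹ * E.c₆ := by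
    have h : ((W'.c₆ : ℚ) : ℂ) = (((q ^ 6)⁻¹ * E.c₆ : ℚ) : ℂ) := by
      rw [e₆, hEL.2, hc₆E]; push_cast; ring
    exact_mod_cast h
  obtain ⟨vc, hC, hCpos⟩ : ∃ vc : VariableChange ℚ, vc • E = W' ∧ 0 < (vc.u : ℚ) := by
    obtain ⟨vc, hC⟩ := exists_variableChange_of_c₄_eq_of_c₆_eq hq0 h₄ h₆
    rcases lt_or_gt_of_ne vc.u.ne_zero with hneg | hpos
    · have hE' : (⟨-1, 0, 0, 0⟩ : VariableChange ℚ) • E = E := by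
        rw [hE, smul_shortModel, inv_neg_one]
        congr 1 <;> push_cast <;> ring
      refine ⟨vc * ⟨-1, 0, 0, 0⟩, by rw [mul_smul, hE', hC], ?_⟩
      show 0 < ((vc.u * -1 : ℚˣ) : ℚ)
      rw [Units.val_mul, Units.val_neg, Units.val_one]
      linarith
    · exact ⟨vc, hC, hpos⟩
  have hCu0 : (vc.u : ℚ) ≠ 0 := vc.u.ne_zero
  -- `‖u(vc)‖_p = ‖q‖_p`
  have hnorm : ‖((vc.u : ℚ) : ℚ_[p])‖ = ‖(q : ℚ_[p])‖ := by
    have hW4 : W'.c₄ = ((vc.u : ℚ))⁻¹ ^ 4 * E.c₄ := by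
      rw [← hC, variableChange_c₄, Units.val_inv_eq_inv_val]
    have hW6 : W'.c₆ = ((vc.u : ℚ))⁻¹ ^ 6 * E.c₆ := by
      rw [← hC, variableChange_c₆, Units.val_inv_eq_inv_val]
    have hΔ : E.c₄ ≠ 0 ∨ E.c₆ ≠ 0 := by
      by_contra hcon
      rw [not_or, not_not, not_not] at hcon
      have h1728 := E.c_relation
      rw [hcon.1, hcon.2] at h1728
      exact E.isUnit_Δ.ne_zero (by linear_combination (1 / 1728 : ℚ) * h1728)
    have key : (vc.u : ℚ) ^ 4 = q ^ 4 ∨ (vc.u : ℚ) ^ 6 = q ^ 6 := by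
      rcases hΔ with hc | hc
      · left
        have h' := mul_right_cancel₀ hc (hW4.symm.trans h₄)
        rw [inv_pow] at h'
        exact inv_injective h'
      · right
        have h' := mul_right_cancel₀ hc (hW6.symm.trans h₆)
        rw [inv_pow] at h'
        exact inv_injective h'
    rcases key with h | h
    · have h' : ‖((vc.u : ℚ) : ℚ_[p])‖ ^ 4 = ‖(q : ℚ_[p])‖ ^ 4 := by
        rw [← norm_pow, ← norm_pow, ← Rat.cast_pow, ← Rat.cast_pow, h]
      exact (pow_left_inj₀ (norm_nonneg _) (norm_nonneg _) (by norm_num)).mp h'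
    · have h' : ‖((vc.u : ℚ) : ℚ_[p])‖ ^ 6 = ‖(q : ℚ_[p])‖ ^ 6 := by
        rw [← norm_pow, ← norm_pow, ← Rat.cast_pow, ← Rat.cast_pow, h]
      exact (pow_left_inj₀ (norm_nonneg _) (norm_nonneg _) (by norm_num)).mp h'
  rw [← hnorm]
  /- Step 4: the parameter `t₀ = θ_C(z)` of `W'` over `ℚ`: `[X¹]t₀ = u`, `log_{W'}(t₀) = u·ℓ`,
  and `t₀, w_{W'}(t₀) ∈ Frac ℤ⟦X⟧` by the dictionary. -/
  have hz1 : coeff 1 z = 1 := by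
    have h1 := congrArg (coeff 1) hlog
    rwa [coeff_one_subst_eq_mul _ hz0, coeff_one_formalLog, one_mul, coeff_mk, Nat.cast_one,
      div_one, W'.isMultiplicative_LFunction.map_one, Int.cast_one] at h1
  set t₀ : ℚ⟦X⟧ := (E.formalVariableChange vc).subst z with ht₀
  have ht₀0 : constantCoeff t₀ = 0 :=
    (constantCoeff_subst_eq_constantCoeff hz0).trans (E.constantCoeff_formalVariableChange vc)
  have ht₀1 : coeff 1 t₀ = (vc.u : ℚ) := by
    rw [ht₀, E.coeff_one_formalVariableChange_subst vc hz0, hz1, mul_one]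
  have hlog₀ : W'.formalLog.subst t₀ = C (vc.u : ℚ) * PowerSeries.mk fun n ↦ ((W'.LFunction n : ℤ) : ℚ) / n := by
    rw [ht₀, ← hlog, ← hC]
    exact E.formalLog_subst_formalVariableChange_subst vc hz0
  obtain ⟨P', Q', hQ', hPQ'⟩ := E.exists_int_frac_formalVariableChange_subst vc hz0 hQ hPQ hQ₂ hPQ₂
  obtain ⟨P₂', Q₂', hQ₂', hPQ₂'⟩ := E.exists_int_frac_formalW_smul_subst vc hz0 hQ hPQ hQ₂ hPQ₂
  rw [← ht₀] at hPQ'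
  rw [hC, ← ht₀] at hPQ₂'
  /- Steps 5–9: the local step over `O = 𝒪_K`. -/
  exact padicNorm_le_one_of_formalLog_subst_eq_of_semistableTwist W' hCpos ht₀0 ht₀1 hlog₀ hQ' hPQ'
    hQ₂' hPQ₂' hψex K πu hπe hke r s t V'' hV'' hfin

/-- **The same at an additive prime, where the Honda witness is free** (`p ∣ Δ_min(W')`,
`p ∣ c₄(W')`; `exists_padicInt_formalLog_subst_eq_lSeriesLog_of_dvd_of_dvd`): a semistable twist
over some `𝒪_K` with `k < e` gives `‖q‖_p ≤ 1` — every `p`, in particular the additive primes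
`2` and `3` left open by `ManinConstantFiniteHeightPrimesProofs`. [cite: EdixhovenManin1991, Prop. 2]
[cite: Honda1970, Thm. 2 (p. 223)] -/
theorem padicNorm_le_one_of_neronLattice_eq_smul_periodLattice_of_semistableTwist_of_dvd_of_dvd
    {N : ℕ} [NeZero N]
    {W' : WeierstrassCurve ℚ} [W'.IsElliptic] [W'.IsGloballyMinimal] {f : CuspForm (Gamma0 N) 2}
    {L' : PeriodPair} (hf : IsNewformOf W' f) (hL' : IsNeronLatticeOf (W'.baseChange ℂ) L')
    {q : ℚ} (hq : ∀ z ∈ periodLattice f, (q : ℂ) * z ∈ L'.lattice)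
    (hq' : ∀ z ∈ L'.lattice, ∃ w ∈ periodLattice f, z = q * w)
    {p : ℕ} [Fact p.Prime] (hΔ : (p : ℤ) ∣ minimalDiscriminantInt W')
    (hc₄ : (p : ℤ) ∣ (integralModelInt W').c₄)
    (K : IntermediateField ℚ_[p] (PadicAlgCl p)) [FiniteDimensional ℚ_[p] K]
    (πu : Kˣ) {e k : ℕ} (hπe : ‖((πu : K) : PadicAlgCl p)‖ ^ e = (p : ℝ)⁻¹) (hke : k < e)
    (r s t : padicCoeffRing K) (V'' : WeierstrassCurve (padicCoeffRing K))
    (hV'' : V''.map (algebraMap (padicCoeffRing K) K) =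
      (⟨πu ^ k, (r : K), (s : K), (t : K)⟩ : VariableChange K) • W'.map (algebraMap ℚ K))
    (hfin : ∃ J : ℕ, 0 < J ∧ IsUnit (coeff J (V''.formalMul p))) :
    ‖(q : ℚ_[p])‖ ≤ 1 :=
  padicNorm_le_one_of_neronLattice_eq_smul_periodLattice_of_semistableTwist hf hL' hq hq'
    (W'.exists_padicInt_formalLog_subst_eq_lSeriesLog_of_dvd_of_dvd hΔ hc₄) K πu hπe hke r s t V'' hV''
    hfin

end Literature.NumberTheory.EllipticCurves
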